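import Literature.Combinatorics.Sahi2008.MeasureFunctional
import Literature.Combinatorics.Sahi2008.FKGCumulation
import Literature.Probability.Percolation.KozmaNitzanPreFKG
import Literature.Probability.LatticeModels.IsingRegionExtension
import Literature.Probability.LatticeModels.IsingBoundaryMonotonicity
import Summits.CriticalPhenomena.PercolationContinuityZ3.Theorems.SahiConjecture
import Summits.CriticalPhenomena.PercolationContinuityZ3.Theorems.SahiThreeCoordinatesDual

/-!
# Sahi's `E_n` for the finite-volume Ising ferromagnet: two free slots unconditionally, all slots under `C_n`

Cell `prim-sahi`, typer, generation 9 (`--supports stmt-CriticalPhenomena-4575`).  Theorems only (no definitions,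
no named facts, no sorries).  The Ising twin of `SahiFKGBondMeasures.lean`.

The tree's finite-volume Gibbs measure `isingMeasure G Λ β h bc` (Friedli–Velenik Def. 3.1: any finite `Λ`, inverse
temperature `β`, homogeneous field `h`, boundary condition `bc`) integrates a measurable observable as the finite
Boltzmann average over `τ : Λ → {−1,+1}` of `f (glue Λ τ bc)` (`integral_isingMeasure`); so its measure-level `E_n`
is the finite-weight `E_n` of the normalised Gibbs weight on the distributive lattice `{−1,+1}^Λ`, for the pulled-back
family (`msahiE_isingMeasure_eq_sahiE`).  That weight is an FKG probability weight for `β ≥ 0`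
(`SahiThreeCoordinates.isFKGMeasure_isingGibbsWeight`, typer gen 4), and `τ ↦ glue Λ τ bc` is monotone
(`glue_monotone`).  Hence:

* UNCONDITIONALLY, every `n` (`β ≥ 0`, any `h`, any `bc`): `0 ≤ E_n(f_0,…,f_{n−1})` under `μ_{Λ;β,h}^{bc}` whenever at
  most two slots are arbitrary nonnegative increasing measurable observables and every other slot is the indicator
  of an all-plus event `{σ : σ_v = +1 ∀ v ∈ A_k}` (`A_k` any finite set of sites; inside `Λ` this is the principal
  up-set of `{−1,+1}^Λ` above `(+ on A_k, − elsewhere)`, outside `Λ` the spins are frozen by `bc` and the event is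
  either unchanged or empty) — `isingMeasure_msahiE_nonneg_plusSpins_offTwo`; `n = 3` displayed:
  `0 ≤ 2μ(P_A ∩ B ∩ C) + μ(P_A)μ(B)μ(C) − μ(P_A)μ(B ∩ C) − μ(B)μ(P_A ∩ C) − μ(C)μ(P_A ∩ B)` for increasing measurable
  events `B, C` and `P_A = {σ_A ≡ +}` (`isingMeasure_sahiE3_plusSpins_nonneg`).  (Sahi's Theorem 2 / Blinovsky's
  theorem with two free slots, `sahiE_nonneg_of_isLatticeCumulation_offTwo`, transported.)
* CONDITIONALLY on `SahiConjecture n`: `E_n ≥ 0` under `μ_{Λ;β,h}^{bc}` for ALL nonnegative increasing (resp.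
  decreasing) measurable families (`isingMeasure_msahiE_nonneg_of_sahiConjecture(_antitone)`).

Typer gen 4 (`SahiThreeCoordinates.lean`) proved `C_n` unconditionally for observables of three fixed spins; here the
observables are arbitrary, at the price of the cumulation constraint on all but two slots.
-/

noncomputable section

namespace Summit.CriticalPhenomena.PercolationContinuityZ3.Theorems.SahiIsingMeasures

open MeasureTheory Finset Literature.Combinatorics.Sahi2008 Literature.Probability.LatticeModels
open Literature.Probability.Percolation

variable {V : Type*} (G : SimpleGraph V) [DecidableEq V] [G.LocallyFinite]

/-! ### The bridge: `E_n` under the Gibbs measure is `E_n` of the Gibbs weight on `{−1,+1}^Λ` -/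

/-- **`E_n` under the finite-volume Ising measure is the finite-weight `E_n` of the normalised Gibbs weight on
`{−1,+1}^Λ`, for the family pulled back along `glue`** (measurable observables). -/
theorem msahiE_isingMeasure_eq_sahiE (Λ : Finset V) (β h : ℝ) (bc : BoundaryCondition V) {n : ℕ}
    (f : Fin n → SpinConfig V → ℝ) (hfm : ∀ i, Measurable (f i)) :
    msahiE (isingMeasure G Λ β h bc) n f =
      sahiE (fun τ : Λ → ℤˣ => isingWeight G Λ β h bc τ / isingPartitionFunction G Λ β h bc) n
        fun i τ => f i (glue Λ τ bc) := by
  refine msahiE_eq_sahiE_of_moments _ _ f _ fun S => ?_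
  have hm : Measurable (∏ i ∈ S, f i) := by
    have e : (∏ i ∈ S, f i) = fun a => ∏ i ∈ S, f i a := funext fun a => Finset.prod_apply a S f
    rw [e]
    exact Finset.measurable_prod S fun i _ => hfm i
  rw [show (∫ x, (∏ i ∈ S, f i) x ∂isingMeasure G Λ β h bc) = isingExpect G Λ β h bc (∏ i ∈ S, f i) from rfl,
    ← SahiThreeCoordinates.ex_isingGibbsWeight_comp_glue G Λ β h bc hm]
  congr 1
  funext τ
  simp only [Finset.prod_apply]

/-! ### All-plus events are cumulations -/

open scoped Classical

/-- **All-plus events pull back to cumulations**: along `glue Λ · bc` the indicator of `{σ_A ≡ +}` is the indicator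
of the principal up-set of `{−1,+1}^Λ` above `(+ on A ∩ Λ, − elsewhere)` when the boundary condition is `+` on
`A \ Λ`, and `0` otherwise — a lattice cumulation in either case. -/
theorem isLatticeCumulation_plusSpins_comp_glue (Λ : Finset V) (bc : BoundaryCondition V) (A : Finset V) :
    IsLatticeCumulation fun τ : Λ → ℤˣ =>
      ({σ : SpinConfig V | ∀ v ∈ A, σ v = 1}.indicator (1 : SpinConfig V → ℝ)) (glue Λ τ bc) := by
  classical
  by_cases hout : ∀ v ∈ A, v ∉ Λ → bc.outside v = 1
  · -- the principal up-set above `c = (+ on A, − elsewhere)`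
    set c : Λ → ℤˣ := fun x => if (x : V) ∈ A then 1 else -1 with hc
    have key : ∀ τ : Λ → ℤˣ, (∀ v ∈ A, glue Λ τ bc v = 1) ↔ c ≤ τ := by
      intro τ
      constructor
      · intro hτ x
        show c x ≤ τ x
        by_cases hxA : (x : V) ∈ A
        · have := hτ x hxA
          rw [glue_apply_of_mem _ _ _ x.2] at this
          rw [hc]
          simp only [hxA, if_true]
          exact this.symm.le
        · rw [hc]
          simp only [hxA, if_false]
          exact neg_one_le_intUnits _
      · intro hcτ v hv
        by_cases hvΛ : v ∈ Λ
        · rw [glue_apply_of_mem _ _ _ hvΛ]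
          have := hcτ ⟨v, hvΛ⟩
          rw [hc] at this
          simp only [hv, if_true] at this
          exact le_antisymm (intUnits_le_one _) this
        · rw [glue_apply_of_notMem _ _ _ hvΛ]
          exact hout v hv hvΛ
    have e : (fun τ : Λ → ℤˣ =>
        ({σ : SpinConfig V | ∀ v ∈ A, σ v = 1}.indicator (1 : SpinConfig V → ℝ)) (glue Λ τ bc)) =
        setInd (principalUp c) := by
      funext τ
      by_cases hτ : ∀ v ∈ A, glue Λ τ bc v = 1
      · rw [Set.indicator_of_mem (show glue Λ τ bc ∈ {σ : SpinConfig V | ∀ v ∈ A, σ v = 1} from hτ),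
          Pi.one_apply, setInd_apply, if_pos (by rw [mem_principalUp]; exact (key τ).1 hτ)]
      · rw [Set.indicator_of_notMem (show glue Λ τ bc ∉ {σ : SpinConfig V | ∀ v ∈ A, σ v = 1} from hτ),
          setInd_apply, if_neg (by rw [mem_principalUp]; exact fun h => hτ ((key τ).2 h))]
    rw [e]
    exact isLatticeCumulation_setInd_principalUp c
  · -- the event is empty on the range of `glue`
    simp only [not_forall] at hout
    obtain ⟨v, hvA, hvΛ, hv⟩ := hout
    have e : (fun τ : Λ → ℤˣ =>
        ({σ : SpinConfig V | ∀ v ∈ A, σ v = 1}.indicator (1 : SpinConfig V → ℝ)) (glue Λ τ bc)) =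
        fun _ => 0 := by
      funext τ
      have hτ : glue Λ τ bc ∉ {σ : SpinConfig V | ∀ v ∈ A, σ v = 1} := by
        intro hτ
        have h1 := hτ v hvA
        rw [glue_apply_of_notMem _ _ _ hvΛ] at h1
        exact hv h1
      exact Set.indicator_of_notMem hτ _
    rw [e]
    refine ⟨fun _ => 0, fun _ => le_rfl, funext fun τ => ?_⟩
    simp

/-! ### Two free slots, unconditionally -/

/-- **Ising ferromagnet, two free slots, unconditional, every `n`**: for `β ≥ 0`, any field `h`, any boundary
condition `bc`, any finite `Λ`: `0 ≤ E_n(f_0,…,f_{n−1})` under `μ_{Λ;β,h}^{bc}` whenever at most two slots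
(`J`, `|J| ≤ 2`) are arbitrary nonnegative increasing measurable observables and every other slot is the indicator
of an all-plus event `{σ_v = +1 ∀ v ∈ A_k}`.  E.g. `n = 4`: `0 ≤ E_4(f, g, 1_{σ_A ≡ +}, 1_{σ_{A'} ≡ +})`. -/
theorem isingMeasure_msahiE_nonneg_plusSpins_offTwo (Λ : Finset V) {β : ℝ} (hβ : 0 ≤ β) (h : ℝ)
    (bc : BoundaryCondition V) {n : ℕ} (J : Finset (Fin n)) (hJ : J.card ≤ 2)
    (f : Fin n → SpinConfig V → ℝ) (hfm : ∀ k, k ∈ J → Measurable (f k)) (hf0 : ∀ k, k ∈ J → ∀ σ, 0 ≤ f k σ)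
    (hmono : ∀ k, k ∈ J → Monotone (f k)) (A : Fin n → Finset V)
    (hplus : ∀ k, k ∉ J → f k = {σ : SpinConfig V | ∀ v ∈ A k, σ v = 1}.indicator 1) :
    0 ≤ msahiE (isingMeasure G Λ β h bc) n f := by
  classical
  have hfm' : ∀ k, Measurable (f k) := by
    intro k
    by_cases hk : k ∈ J
    · exact hfm k hk
    · rw [hplus k hk]
      exact (measurable_const.indicator (measurableSet_forall_mem_eq_one (A k)))
  rw [msahiE_isingMeasure_eq_sahiE G Λ β h bc f hfm']
  refine sahiE_nonneg_of_isLatticeCumulation_offTwo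
    (SahiThreeCoordinates.isFKGMeasure_isingGibbsWeight G Λ hβ h bc) _ (fun k τ => ?_) (fun k => ?_) J hJ
    fun k hk => ?_
  · by_cases hk : k ∈ J
    · exact hf0 k hk _
    · rw [hplus k hk]
      exact Set.indicator_nonneg (fun _ _ => zero_le_one) _
  · by_cases hk : k ∈ J
    · exact (hmono k hk).comp (glue_monotone Λ bc)
    · rw [hplus k hk]
      exact (KNPreFKG.monotone_indicator_one_of_isUpperSet (isUpperSet_forall_mem_eq_one (A k))).comp
        (glue_monotone Λ bc)
  · show IsLatticeCumulation fun τ : Λ → ℤˣ => f k (glue Λ τ bc)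
    rw [hplus k hk]
    exact isLatticeCumulation_plusSpins_comp_glue Λ bc (A k)

/-- **Ising, `n = 3` displayed**: for `β ≥ 0`, any `h`, `bc`, finite `Λ`, a finite set of sites `A` with
`P_A = {σ_v = +1 ∀ v ∈ A}` and increasing measurable events `B, C`:
`0 ≤ E_3(1_{P_A}, 1_B, 1_C) = 2μ(P_A ∩ B ∩ C) + μ(P_A)μ(B)μ(C) − (μ(P_A)μ(B ∩ C) + μ(B)μ(P_A ∩ C) + μ(C)μ(P_A ∩ B))`
under `μ = μ_{Λ;β,h}^{bc}`. -/
theorem isingMeasure_sahiE3_plusSpins_nonneg (Λ : Finset V) {β : ℝ} (hβ : 0 ≤ β) (h : ℝ)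
    (bc : BoundaryCondition V) (A : Finset V) {B C : Set (SpinConfig V)} (hBm : MeasurableSet B)
    (hB : IsUpperSet B) (hCm : MeasurableSet C) (hC : IsUpperSet C) :
    0 ≤ sahiE3 (isingMeasure G Λ β h bc) {σ : SpinConfig V | ∀ v ∈ A, σ v = 1} B C := by
  rw [← msahiE_three_indicator _ (measurableSet_forall_mem_eq_one A) hBm hCm]
  refine isingMeasure_msahiE_nonneg_plusSpins_offTwo G Λ hβ h bc ({1, 2} : Finset (Fin 3)) (by decide) _
    ?_ ?_ ?_ ![A, A, A] ?_
  · intro k hk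
    fin_cases k
    · simp at hk
    · exact measurable_const.indicator hBm
    · exact measurable_const.indicator hCm
  · intro k hk σ
    fin_cases k
    · simp at hk
    · exact Set.indicator_nonneg (fun _ _ => zero_le_one) σ
    · exact Set.indicator_nonneg (fun _ _ => zero_le_one) σ
  · intro k hk
    fin_cases k
    · simp at hk
    · exact KNPreFKG.monotone_indicator_one_of_isUpperSet hB
    · exact KNPreFKG.monotone_indicator_one_of_isUpperSet hC
  · intro k hk
    fin_cases k
    · rfl
    · simp at hk
    · simp at hk

/-! ### All slots, under Sahi's conjecture `C_n` -/

/-- **`C_n` ⇒ the finite-volume Ising measures are Sahi-positive of order `n`** (increasing families): under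
`SahiConjecture n`, for `β ≥ 0`, any `h`, `bc`, finite `Λ`, and all nonnegative increasing measurable observables
`f_0,…,f_{n−1}`: `0 ≤ E_n(f_0,…,f_{n−1})` under `μ_{Λ;β,h}^{bc}`. -/
theorem isingMeasure_msahiE_nonneg_of_sahiConjecture {V : Type} (G : SimpleGraph V) [DecidableEq V]
    [G.LocallyFinite] {n : ℕ} (hC : SahiConjecture n) (Λ : Finset V) {β : ℝ} (hβ : 0 ≤ β) (h : ℝ)
    (bc : BoundaryCondition V) (f : Fin n → SpinConfig V → ℝ) (hfm : ∀ i, Measurable (f i))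
    (hf0 : ∀ i σ, 0 ≤ f i σ) (hmono : ∀ i, Monotone (f i)) : 0 ≤ msahiE (isingMeasure G Λ β h bc) n f := by
  rw [msahiE_isingMeasure_eq_sahiE G Λ β h bc f hfm]
  exact hC (Λ → ℤˣ) _ (SahiThreeCoordinates.isFKGMeasure_isingGibbsWeight G Λ hβ h bc) _
    (fun i τ => hf0 i _) fun i => (hmono i).comp (glue_monotone Λ bc)

/-- **`C_n` ⇒ Ising Sahi positivity, decreasing families** (e.g. indicators of all-minus events). -/
theorem isingMeasure_msahiE_nonneg_of_sahiConjecture_antitone {V : Type} (G : SimpleGraph V) [DecidableEq V]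
    [G.LocallyFinite] {n : ℕ} (hC : SahiConjecture n) (Λ : Finset V) {β : ℝ} (hβ : 0 ≤ β) (h : ℝ)
    (bc : BoundaryCondition V) (f : Fin n → SpinConfig V → ℝ) (hfm : ∀ i, Measurable (f i))
    (hf0 : ∀ i σ, 0 ≤ f i σ) (hanti : ∀ i, Antitone (f i)) : 0 ≤ msahiE (isingMeasure G Λ β h bc) n f := by
  rw [msahiE_isingMeasure_eq_sahiE G Λ β h bc f hfm, ← SahiThreeCoordinates.sahiE_dual]
  exact hC (Λ → ℤˣ)ᵒᵈ _
    (SahiThreeCoordinates.isFKGMeasure_dual (SahiThreeCoordinates.isFKGMeasure_isingGibbsWeight G Λ hβ h bc)) _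
    (fun i τ => hf0 i _) fun i => ((hanti i).comp_monotone (glue_monotone Λ bc)).dual_left

end Summit.CriticalPhenomena.PercolationContinuityZ3.Theorems.SahiIsingMeasures
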